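import Mathlib
import Summits.NavierStokesRegularity.NavierStokesRegularity.Theorems.LerayQuarterDissipationFiniteDissipationLiouvilleSmallDissipationGapSharperStretching
import HarnessLib

/-!
# Small-dissipation gap for the finite-dissipation stratum, SHARPER CONSTANT, file 2/3: the
  localised similarity-enstrophy budget for every `θ = √K_U (√K_S)³ < (64/27)^{1/4}`
  (route `LerayQuarterDissipation`, crux `FiniteDissipationLiouville` stmt-NavierStokesRegularity-22144,
  BC5 rung `stub_smallDissipationGap`; lead prover g14, helper)

HONEST FRAMING. Label-free analysis helper about a HYPOTHETICAL object (a Type-I ancient mild field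
in the KNSS gauge) under the additional hypothesis `∫‖DU(s)‖² ≤ K_U` on the similarity slices.
Nothing here bears on Navier–Stokes regularity or blow-up; no summit is proved.

CONTENTS. `deriv_sqCutoffEnstrophy_le_sharper` — if `θ⁴ < 64/27` there are `κ > 0`, `L ≥ 0` with
`Z_R' ≤ −κ Z_R + (L/R)∫_{B̄_{2R}}‖Ω‖²` for all `R ≥ 1` and all `s` (`Z_R = ∫φ_R²‖Ω‖²`). Proof: the
identity `deriv_sqCutoffEnstrophy_eq` (T31⁗), the flux bounds of `deriv_sqCutoffEnstrophy_le`, and the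
weighted stretching bound of file 1/3 with `θ` enlarged to `θ₁ = max θ 1`, `δ = min 1 ((ρ−1)/14)`,
`ρ = 64/(27θ₁⁴) > 1`, and the Young weight `m⁴ = 3θ₁(1+δ)/4`, which cancels the dissipation `−2∫φ²‖∇Ω‖²`
exactly and leaves the damping `κ = ½ − 27θ₁⁴(1+δ)³/128 > 0`. The tree's `deriv_sqCutoffEnstrophy_le`
is the case `θ ≤ 2/3` (`κ = 1/6`); the present threshold `(64/27)^{1/4} ≈ 1.2408` enlarges the admissible
dissipation constant `K_U` by the factor `2√3 ≈ 3.46`. File 3/3 (`…SmallDissipationGapSharper`) is the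
Liouville theorem. [folklore energy method; Ladyzhenskaya's inequality]
-/

noncomputable section

set_option linter.dupNamespace false

namespace Summit.NavierStokesRegularity.NavierStokesRegularity.Theorems.SmallDissipationGap

open MeasureTheory Set Filter Topology Metric InnerProductSpace Function Real
open scoped RealInnerProductSpace Laplacian ContDiff
open Literature.Analysis Literature.Analysis.FluidPDE
open Summit.NavierStokesRegularity.NavierStokesRegularity.Theorems
open Summit.NavierStokesRegularity.NavierStokesRegularity.Theorems.GaussianGap
open Summit.NavierStokesRegularity.NavierStokesRegularity.Theorems.SimilarityEnstrophy

variable {C : ℝ} {V : ℝ → (EuclideanSpace ℝ (Fin 3)) → (EuclideanSpace ℝ (Fin 3))}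

/-! ### The budget for every `θ⁴ < 64/27` -/

/-- **The localised similarity-enstrophy inequality below the SHARPER small-dissipation threshold.**
Let `V` be a KNSS-gauge Type-I field with `∫‖DU(s)‖² ≤ K_U` for all `s` and
`θ = √K_U·(√K_S)³` with `θ⁴ < 64/27`. Then there are `κ > 0` and `L ≥ 0` such that for every
`R ≥ 1` and every `s`: `Z_R'(s) ≤ −κ Z_R(s) + (L/R)∫_{B̄_{2R}}‖Ω(s)‖²`, `Z_R = ∫φ_R²‖Ω‖²` (choose
`δ > 0` with `θ₁⁴(1+δ)³ < 64/27`, `θ₁ = max θ 1`, and `m⁴ = 3θ₁(1+δ)/4`: the dissipation cancels exactly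
and `κ = ½ − 27θ₁⁴(1+δ)³/128`). [folklore energy method] -/
theorem deriv_sqCutoffEnstrophy_le_sharper (hV : IsTypeIAncientMild C V) {KU : ℝ}
    (hint : ∀ s : ℝ, Integrable (fun y => ‖fderiv ℝ (lerayOrbit V s) y‖ ^ 2))
    (hKU : ∀ s : ℝ, ∫ y, ‖fderiv ℝ (lerayOrbit V s) y‖ ^ 2 ≤ KU)
    (hθ : (Real.sqrt KU * Real.sqrt (SNormLESNormFDerivOfEqConst (EuclideanSpace ℝ (Fin 3)) (volume : Measure (EuclideanSpace ℝ (Fin 3))) 2 : ℝ) ^ 3) ^ 4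
      < 64 / 27) :
    ∃ κ : ℝ, 0 < κ ∧ ∃ L : ℝ, 0 ≤ L ∧ ∀ R : ℝ, 1 ≤ R → ∀ s : ℝ,
      deriv (fun σ => ∫ y, smoothTransition (2 - ‖y‖ ^ 2 / R ^ 2) ^ 2 * ‖lerayVorticity V σ y‖ ^ 2) s ≤
        -κ * (∫ y, smoothTransition (2 - ‖y‖ ^ 2 / R ^ 2) ^ 2 * ‖lerayVorticity V s y‖ ^ 2) +
          L / R * ∫ y in closedBall (0 : (EuclideanSpace ℝ (Fin 3))) (2 * R), ‖lerayVorticity V s y‖ ^ 2 := by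
  obtain ⟨c₁, hc₁0, hc₁⟩ :=
    exists_norm_fderiv_smoothTransition_cutoff_le (E := (EuclideanSpace ℝ (Fin 3)))
  obtain ⟨c₂, hc₂0, hc₂⟩ :=
    exists_abs_laplacian_smoothTransition_cutoff_le (E := (EuclideanSpace ℝ (Fin 3)))
  have hC : 0 ≤ C := hV.nonneg
  set θ : ℝ := Real.sqrt KU * Real.sqrt (SNormLESNormFDerivOfEqConst (EuclideanSpace ℝ (Fin 3)) (volume : Measure (EuclideanSpace ℝ (Fin 3))) 2 : ℝ) ^ 3
    with hθdef
  have hθ0 : 0 ≤ θ := by positivity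
  -- enlarge `θ` to `θ₁ = max θ 1 > 0`, still below the threshold
  set θ₁ : ℝ := max θ 1 with hθ₁
  have hθ₁1 : 1 ≤ θ₁ := le_max_right _ _
  have hθ₁pos : 0 < θ₁ := lt_of_lt_of_le one_pos hθ₁1
  have hθθ₁ : θ ≤ θ₁ := le_max_left _ _
  have hθ₁4 : θ₁ ^ 4 < 64 / 27 := by
    rcases le_total θ 1 with h | h
    · rw [hθ₁, max_eq_right h]; norm_num
    · rw [hθ₁, max_eq_left h]; exact hθ
  -- the margin `ρ = 64/(27 θ₁⁴) > 1` and the product-rule weight `δ`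
  set ρ : ℝ := 64 / 27 / θ₁ ^ 4 with hρ
  have hθ₁4pos : 0 < θ₁ ^ 4 := by positivity
  have hρ1 : 1 < ρ := by rw [hρ, lt_div_iff₀ hθ₁4pos]; linarith
  set δ : ℝ := min 1 ((ρ - 1) / 14) with hδdef
  have hδpos : 0 < δ := lt_min one_pos (by linarith)
  have hδ1 : δ ≤ 1 := min_le_left _ _
  have hδρ : (1 + δ) ^ 3 < ρ := by
    have h1 : δ ≤ (ρ - 1) / 14 := min_le_right _ _
    have hδ2 : δ ^ 2 ≤ δ := by nlinarith
    have hδ3 : δ ^ 3 ≤ δ := by nlinarith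
    have h2 : (1 + δ) ^ 3 ≤ 1 + 7 * δ := by nlinarith
    linarith
  -- the damping left after cancelling the dissipation
  set ν : ℝ := 27 * θ₁ ^ 4 * (1 + δ) ^ 3 / 128 with hνdef
  have hνlt : ν < 1 / 2 := by
    have h1 : θ₁ ^ 4 * (1 + δ) ^ 3 < θ₁ ^ 4 * ρ := mul_lt_mul_of_pos_left hδρ hθ₁4pos
    have e : θ₁ ^ 4 * ρ = 64 / 27 := by rw [hρ]; field_simp
    rw [hνdef]
    rw [e] at h1
    linarith
  have hν0 : 0 ≤ ν := by positivity
  -- the Young weight `m` with `m⁴ = 3 θ₁ (1+δ)/4`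
  set q : ℝ := 3 * θ₁ * (1 + δ) / 4 with hq
  have hqpos : 0 < q := by positivity
  set m : ℝ := Real.sqrt (Real.sqrt q) with hm
  have hmpos : 0 < m := Real.sqrt_pos.2 (Real.sqrt_pos.2 hqpos)
  have hm4 : m ^ 4 = q := by
    rw [show m ^ 4 = (m ^ 2) ^ 2 by ring, hm, Real.sq_sqrt (Real.sqrt_nonneg _), Real.sq_sqrt hqpos.le]
  have hm12 : m ^ 12 = q ^ 3 := by rw [show m ^ 12 = (m ^ 4) ^ 3 by ring, hm4]
  refine ⟨1 / 2 - ν, by linarith, 2 * C * c₁ + 2 * c₂ + 6 * c₁ ^ 2 + 2 * c₁ ^ 2 / δ, by positivity,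
    fun R hR1 s => ?_⟩
  have hR : 0 < R := lt_of_lt_of_le one_pos hR1
  rw [deriv_sqCutoffEnstrophy_eq hV hR s]
  set φ : (EuclideanSpace ℝ (Fin 3)) → ℝ := fun z => smoothTransition (2 - ‖z‖ ^ 2 / R ^ 2) with hφdef
  set Ω := lerayVorticity V s with hΩdef
  set U := lerayOrbit V s with hUdef
  set I : ℝ := ∫ y in closedBall (0 : (EuclideanSpace ℝ (Fin 3))) (2 * R), ‖Ω y‖ ^ 2 with hIdef
  set Z : ℝ := ∫ y, φ y ^ 2 * ‖Ω y‖ ^ 2 with hZdef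
  set D : ℝ := ∫ y, φ y ^ 2 * frobeniusNormSq (fderiv ℝ Ω y) with hDdef
  have hI0 : 0 ≤ I := integral_nonneg fun y => sq_nonneg _
  have hZ0 : 0 ≤ Z := integral_nonneg fun y => mul_nonneg (sq_nonneg _) (sq_nonneg _)
  have hD0 : 0 ≤ D := integral_nonneg fun y => mul_nonneg (sq_nonneg _) (frobeniusNormSq_nonneg _)
  have hΩ1 : ContDiff ℝ 1 Ω := signedBudget_contDiff_lerayVorticity_slice hV s (n := 1)
  have hcΩ : Continuous Ω := hΩ1.continuous
  have hUC : ∀ y, ‖U y‖ ≤ C := fun y => norm_lerayOrbit_le_of_typeI hV s y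
  have hw1 : ContDiff ℝ 1 fun z : (EuclideanSpace ℝ (Fin 3)) => φ z ^ 2 := contDiff_sqCutoff (n := 1) R
  have hw2 : ContDiff ℝ 2 fun z : (EuclideanSpace ℝ (Fin 3)) => φ z ^ 2 := contDiff_sqCutoff (n := 2) R
  have hcDw : Continuous (fderiv ℝ fun z : (EuclideanSpace ℝ (Fin 3)) => φ z ^ 2) := hw1.continuous_fderiv one_ne_zero
  -- (1) drift flux `≤ 0`
  have hDrift : (∫ y, fderiv ℝ (fun z : (EuclideanSpace ℝ (Fin 3)) => φ z ^ 2) y y * ‖Ω y‖ ^ 2) ≤ 0 :=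
    integral_nonpos fun y => mul_nonpos_iff.2 (Or.inr ⟨fderiv_sqCutoff_self_nonpos R y, sq_nonneg _⟩)
  -- (2) transport flux
  have hT : |∫ y, fderiv ℝ (fun z : (EuclideanSpace ℝ (Fin 3)) => φ z ^ 2) y (U y) * ‖Ω y‖ ^ 2| ≤ C * (2 * (c₁ / R)) * I := by
    refine abs_integral_le_of_weight_sq hcΩ (w := fun y => C * ‖fderiv ℝ (fun z : (EuclideanSpace ℝ (Fin 3)) => φ z ^ 2) y‖)
      (continuous_const.mul hcDw.norm) (fun y hy => ?_) (fun y _ => ?_) (fun y => ?_)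
    · show C * ‖fderiv ℝ (fun z : (EuclideanSpace ℝ (Fin 3)) => φ z ^ 2) y‖ = 0
      rw [hφdef, fderiv_sqCutoff_eq_zero hR hy, norm_zero, mul_zero]
    · exact mul_le_mul_of_nonneg_left (norm_fderiv_sqCutoff_le hc₁ hR y) hC
    · rw [abs_mul, abs_of_nonneg (sq_nonneg ‖Ω y‖)]
      have e1 : |fderiv ℝ (fun z : (EuclideanSpace ℝ (Fin 3)) => φ z ^ 2) y (U y)| ≤
          ‖fderiv ℝ (fun z : (EuclideanSpace ℝ (Fin 3)) => φ z ^ 2) y‖ * C := by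
        rw [← Real.norm_eq_abs]
        exact (ContinuousLinearMap.le_opNorm _ _).trans
          (mul_le_mul_of_nonneg_left (hUC y) (norm_nonneg _))
      calc |fderiv ℝ (fun z : (EuclideanSpace ℝ (Fin 3)) => φ z ^ 2) y (U y)| * ‖Ω y‖ ^ 2
          ≤ (‖fderiv ℝ (fun z : (EuclideanSpace ℝ (Fin 3)) => φ z ^ 2) y‖ * C) * ‖Ω y‖ ^ 2 :=
            mul_le_mul_of_nonneg_right e1 (sq_nonneg _)
        _ = C * ‖fderiv ℝ (fun z : (EuclideanSpace ℝ (Fin 3)) => φ z ^ 2) y‖ * ‖Ω y‖ ^ 2 := by ring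
  -- (3) viscous flux
  have hVisc : |∫ y, ‖Ω y‖ ^ 2 * (Δ (fun z : (EuclideanSpace ℝ (Fin 3)) => φ z ^ 2)) y| ≤
      (2 * (c₂ / R ^ 2) + 6 * (c₁ / R) ^ 2) * I := by
    refine abs_integral_le_of_weight_sq hcΩ (w := fun y => |(Δ (fun z : (EuclideanSpace ℝ (Fin 3)) => φ z ^ 2)) y|)
      (continuous_laplacian hw2).abs (fun y hy => ?_) (fun y _ => ?_) (fun y => ?_)
    · show |(Δ (fun z : (EuclideanSpace ℝ (Fin 3)) => φ z ^ 2)) y| = 0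
      rw [hφdef, laplacian_sqCutoff_eq_zero hR hy, abs_zero]
    · exact abs_laplacian_sqCutoff_le hc₁ hc₂ hR y
    · rw [abs_mul, abs_of_nonneg (sq_nonneg ‖Ω y‖), mul_comm]
  -- (4) stretching, weighted, with `θ` enlarged to `θ₁`
  have hS0 := two_mul_integral_sqCutoff_stretching_le_weighted hV hc₁ hR s (hint s) (hKU s) hδpos hmpos
  rw [← hθdef] at hS0
  have hS : 2 * (∫ y, φ y ^ 2 * ⟪fderiv ℝ U y (Ω y), Ω y⟫) ≤
      (θ₁ * m ^ 12 / 2) * Z + (3 * θ₁ / (2 * m ^ 4)) * (1 + δ) * D +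
        (3 * θ₁ / (2 * m ^ 4)) * (1 + δ⁻¹) * (c₁ / R) ^ 2 * I := by
    have h1 : (θ * m ^ 12 / 2) * Z ≤ (θ₁ * m ^ 12 / 2) * Z :=
      mul_le_mul_of_nonneg_right (by gcongr) hZ0
    have h2 : (3 * θ / (2 * m ^ 4)) * (1 + δ) * D ≤ (3 * θ₁ / (2 * m ^ 4)) * (1 + δ) * D := by
      have : 3 * θ / (2 * m ^ 4) ≤ 3 * θ₁ / (2 * m ^ 4) := by gcongr
      exact mul_le_mul_of_nonneg_right (mul_le_mul_of_nonneg_right this (by linarith)) hD0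
    have h3 : (3 * θ / (2 * m ^ 4)) * (1 + δ⁻¹) * (c₁ / R) ^ 2 * I ≤
        (3 * θ₁ / (2 * m ^ 4)) * (1 + δ⁻¹) * (c₁ / R) ^ 2 * I := by
      have : 3 * θ / (2 * m ^ 4) ≤ 3 * θ₁ / (2 * m ^ 4) := by gcongr
      have hδi : 0 ≤ 1 + δ⁻¹ := by positivity
      exact mul_le_mul_of_nonneg_right (mul_le_mul_of_nonneg_right
        (mul_le_mul_of_nonneg_right this hδi) (sq_nonneg _)) hI0
    linarith [hS0, h1, h2, h3]
  -- the chosen weights: dissipation coefficient `= 2`, damping coefficient `= ν`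
  have hcoefD : (3 * θ₁ / (2 * m ^ 4)) * (1 + δ) = 2 := by
    rw [hm4, hq]; field_simp; ring
  have hcoefZ : θ₁ * m ^ 12 / 2 = ν := by
    rw [hm12, hq, hνdef]; ring
  have hcoefI : (3 * θ₁ / (2 * m ^ 4)) * (1 + δ⁻¹) = 2 / δ := by
    rw [hm4, hq]; field_simp; ring
  rw [hcoefD, hcoefZ, hcoefI] at hS
  -- absorption
  have hT' := (le_abs_self _).trans hT
  have hVisc' := (le_abs_self _).trans hVisc
  have hR2 : 1 / R ^ 2 ≤ 1 / R := by
    apply one_div_le_one_div_of_le hR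
    calc R = 1 * R := (one_mul R).symm
      _ ≤ R * R := mul_le_mul_of_nonneg_right hR1 hR.le
      _ = R ^ 2 := (sq R).symm
  have hc₂R : c₂ / R ^ 2 ≤ c₂ / R := by
    have := mul_le_mul_of_nonneg_left hR2 hc₂0
    simpa only [mul_one_div] using this
  have hc₁R : (c₁ / R) ^ 2 ≤ c₁ ^ 2 / R := by
    rw [div_pow]
    have := mul_le_mul_of_nonneg_left hR2 (sq_nonneg c₁)
    simpa only [mul_one_div] using this
  have a3 : 2 / δ * (c₁ / R) ^ 2 * I ≤ (2 * c₁ ^ 2 / δ) / R * I := by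
    have h1 : 2 / δ * (c₁ / R) ^ 2 ≤ 2 / δ * (c₁ ^ 2 / R) :=
      mul_le_mul_of_nonneg_left hc₁R (by positivity)
    have e : 2 / δ * (c₁ ^ 2 / R) = (2 * c₁ ^ 2 / δ) / R := by field_simp
    exact mul_le_mul_of_nonneg_right (h1.trans_eq e) hI0
  have a4 : (2 * (c₂ / R ^ 2) + 6 * (c₁ / R) ^ 2) * I ≤ (2 * (c₂ / R) + 6 * (c₁ ^ 2 / R)) * I :=
    mul_le_mul_of_nonneg_right (by linarith [hc₂R, hc₁R]) hI0
  have e : (2 * C * c₁ + 2 * c₂ + 6 * c₁ ^ 2 + 2 * c₁ ^ 2 / δ) / R * I =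
      C * (2 * (c₁ / R)) * I + (2 * (c₂ / R) + 6 * (c₁ ^ 2 / R)) * I + (2 * c₁ ^ 2 / δ) / R * I := by
    field_simp
    ring
  rw [e]
  have eZ : -(1 / 2 - ν) * Z = -(1 / 2) * Z + ν * Z := by ring
  linarith [hDrift, hT', hVisc', hS, a3, a4, eZ]

end Summit.NavierStokesRegularity.NavierStokesRegularity.Theorems.SmallDissipationGap

end
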